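import Summits.AnomalousDissipation.AnomalousDissipation.Theorems.SawtoothPulseCascadeK3NonlinearClosureStubHalfPulseEnergyBound
import HarnessLib

/-!
# K3′ `K3NonlinearClosure` (aside, stmt-AnomalousDissipation-20027), line `Localised` — the ν-uniform weak energy
growth for an ARBITRARY `L²` datum (reusable form of the tools of STUB S2c)

`K3NonlinearClosureLocalised.ae_integral_norm_sq_le_mul_exp` (p798498, `…WeakEnergyGrowth.lean`) asks for a weakly
divergence-free datum; `K3NonlinearClosureLocalised.exists_weaklyDivFree_datum` (p799028, `…StubHalfPulseEnergyBound.lean`)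
removes that proviso (the weak formulation of `Torus.IsWeakPassiveVectorOn` only sees the Leray part of the datum).
Their composition is the statement weak-class K2-type items quantify over (all `L²` data).  No definitions.
-/

-- `Summit.<Summit>.<Problem>`: single-conjunct summit, the duplicate namespace segment is deliberate.
set_option linter.dupNamespace false

noncomputable section

open MeasureTheory Set Filter
open scoped ENNReal NNReal InnerProductSpace
open Literature.Analysis Literature.Analysis.FluidPDE Literature.Analysis.FluidPDE.Torus

namespace Summit.AnomalousDissipation.AnomalousDissipation.Theorems.SawtoothPulseCascade.K3NonlinearClosureLocalised

variable {d : Type*} [Fintype d] [DecidableEq d]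

/-- **ν-uniform energy growth for weak passive vectors, arbitrary `L²` datum**: for a weak solution of
`∂ₜw + (b·∇)w + A (w·∇)b + ∇π = νΔw`, `∇·w = 0` in the class `IsWeakPassiveVectorOn A T ν b w₀ w` with `ν > 0`,
`stLift b ∈ L^∞((0,T) × T^d)`, ANY datum `w₀ ∈ L²` (not necessarily divergence free — only its Leray part is seen by
the weak formulation) and the production bound `A ∫⟪b(s), (v·∇)v⟫ ≤ Λ(s) ∫‖v‖²` on smooth divergence-free `v`
(`Λ ≥ 0` continuous), for a.e. `t ∈ (0,T)`: `∫‖w(t)‖² ≤ (∫‖w₀‖²) · exp (∫₀ᵗ 2Λ)` — uniformly in `ν`.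
[cite: MajdaBertozziCUP2002, §3.1.1 Prop. 3.1 (3.7) (energy growth by the velocity-gradient rate)] [cite: RobinsonRodrigoSadowski2016, §4.2 (4.20) and Thm. 2.6 / Def. 2.8 (Leray projector)] -/
theorem ae_integral_norm_sq_le_mul_exp_of_memLp {A T ν : ℝ} {b w : ℝ → UnitAddTorus d → EuclideanSpace ℝ d}
    {w₀ : UnitAddTorus d → EuclideanSpace ℝ d}
    (h : IsWeakPassiveVectorOn A T ν b w₀ w) (hν : 0 < ν) (hw₀ : MemLp w₀ 2 volume)
    (hb : MemLp (FunctionSpaces.Torus.stLift b) ∞ (volume.restrict (Ioo 0 T ×ˢ univ)))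
    {Λ : ℝ → ℝ} (hΛc : Continuous Λ) (hΛ0 : ∀ s, 0 ≤ Λ s)
    (hprod : ∀ᵐ s ∂(volume.restrict (Ioo 0 T)), ∀ v : UnitAddTorus d → EuclideanSpace ℝ d,
      FunctionSpaces.Torus.IsSmooth v → FunctionSpaces.Torus.IsDivFree v →
      A * ∫ x, ⟪b s x, FunctionSpaces.Torus.convect v v x⟫_ℝ ≤ Λ s * ∫ x, ‖v x‖ ^ 2) :
    ∀ᵐ t ∂(volume.restrict (Ioo 0 T)),
      ∫ x, ‖w t x‖ ^ 2 ≤ (∫ x, ‖w₀ x‖ ^ 2) * Real.exp (∫ s in (0:ℝ)..t, 2 * Λ s) := by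
  obtain ⟨w₀', hw₀', hdiv', hle', hw'⟩ := exists_weaklyDivFree_datum h hw₀
  filter_upwards [ae_integral_norm_sq_le_mul_exp hw' hν hw₀' hdiv' hb hΛc hΛ0 hprod] with t ht
  exact ht.trans (mul_le_mul_of_nonneg_right hle' (Real.exp_pos _).le)

end Summit.AnomalousDissipation.AnomalousDissipation.Theorems.SawtoothPulseCascade.K3NonlinearClosureLocalised

end
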